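import Summits.Ventures.Crystal3D.Theorems.StickyWulffConstantCoaxialWallLawTwoSided
import HarnessLib

/-!
# The two-sided layered rung of `stub_coaxialTwoSlabAdhesion`: constant `2√6/3` on the co-axial site lattice

HONEST FRAMING. Part of the venture `Summits/Ventures/Crystal3D` (cell `crystal3d-full`), helper
`--supports` the crux `CoaxialWallLaw` (stmt-Ventures-19481, `route-Ventures-StickyWulffConstant`),
REGISTERED line `WallLedgerF` (planner cf-p1 gen 16), open stub `stub_coaxialTwoSlabAdhesion`.
RUNG CREDIT ONLY; F-C1 not moved.  Sharpens `…CoaxialWallLawLayered.coaxialTwoSlabAdhesion_layered_sharp`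
(constant `√6/3`, grain 1's rows) by charging both grains' rows (`…CoaxialWallLawTwoSided`):

* **`coaxialTwoSlabAdhesion_layered_twoSided`** — for the crux's frame data `(L, s₁, s₂, σ, σ')`, `Λ₁ ≠ Λ₂`,
  and every filling of the stub's cell supported on the co-axial site lattice of `(L, s₁)`:
  `cross(P₁, X∖P₁) + cross(P₂, Y) ≤ D(Y) + (φ₁ + φ₂ − (2√6/3)·√(1 − ⟪L e₃, e₃⟫²)) πρ² + C(1+h)ρ`
  (`2√6/3 ≈ 1.633`; the cell's rigid-site optimum at `{112}` is `√6 ≈ 2.449`).  No compatibility hypothesis: if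
  `s₂ − s₁` is not a site vector, no ball of `Λ₂` is a site while the complete top sample is never empty
  (`movedFcc_exists_dist_sq_le_half`), so the on-site premise is contradictory and the bound holds vacuously;
  otherwise it is `coaxialTwoSlabAdhesion_offSite_twoSided` with an empty budget.

WHAT THIS IS NOT: nothing off-site; F-C1 not moved.
-/

noncomputable section

namespace Summit.Ventures.Crystal3D.Theorems

open Summit.Ventures.Crystal3D Finset
open Literature.MathematicalPhysics.StatisticalMechanics (fccStacking barlowStacking IsHaggSeq
  contactDeficiency triangularVec₁ triangularVec₂ barlowOffset layerNormal)
open scoped InnerProductSpace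

open scoped Classical in
/-- **The two-sided layered rung** (on-site fillings, constant `2√6/3`).  See the module docstring. -/
theorem coaxialTwoSlabAdhesion_layered_twoSided
    (A₁ : EuclideanSpace ℝ (Fin 3) ≃ₗᵢ[ℝ] EuclideanSpace ℝ (Fin 3)) (t₁ : EuclideanSpace ℝ (Fin 3))
    (A₂ : EuclideanSpace ℝ (Fin 3) ≃ₗᵢ[ℝ] EuclideanSpace ℝ (Fin 3)) (t₂ : EuclideanSpace ℝ (Fin 3))
    (L : EuclideanSpace ℝ (Fin 3) ≃ₗᵢ[ℝ] EuclideanSpace ℝ (Fin 3)) (s₁ s₂ : EuclideanSpace ℝ (Fin 3))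
    {σ σ' : ℤ → ℤ} (hσ : IsHaggSeq σ) (hσ' : IsHaggSeq σ')
    (hsub₁ : (fun p => A₁ p + t₁) '' fccStacking 1 (Real.sqrt (2 / 3)) ⊆
      (fun p => L p + s₁) '' barlowStacking 1 (Real.sqrt (2 / 3)) σ)
    (hsub₂ : (fun p => A₂ p + t₂) '' fccStacking 1 (Real.sqrt (2 / 3)) ⊆
      (fun p => L p + s₂) '' barlowStacking 1 (Real.sqrt (2 / 3)) σ')
    (hne : (fun p => A₁ p + t₁) '' fccStacking 1 (Real.sqrt (2 / 3)) ≠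
      (fun p => A₂ p + t₂) '' fccStacking 1 (Real.sqrt (2 / 3)))
 :
    ∃ C R₀ : ℝ, 1 ≤ R₀ ∧ ∀ h : ℝ, 0 ≤ h → ∀ ρ : ℝ, R₀ ≤ ρ →
      ∀ X P₁ P₂ : Finset (EuclideanSpace ℝ (Fin 3)),
      (∀ p ∈ X, ∀ q ∈ X, p ≠ q → 1 ≤ dist p q) → P₁ ⊆ X → P₂ ⊆ X \ P₁ →
      (∀ p ∈ X, -(2 * R₀) ≤ p 2 ∧ p 2 ≤ h + 2 * R₀ ∧ p 0 ^ 2 + p 1 ^ 2 ≤ ρ ^ 2) →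
      (∀ p, p ∈ P₁ ↔ (p ∈ (fun q => A₁ q + t₁) '' fccStacking 1 (Real.sqrt (2 / 3)) ∧
        -(2 * R₀) ≤ p 2 ∧ p 2 ≤ -R₀ ∧ p 0 ^ 2 + p 1 ^ 2 ≤ ρ ^ 2)) →
      (∀ p, p ∈ P₂ ↔ (p ∈ (fun q => A₂ q + t₂) '' fccStacking 1 (Real.sqrt (2 / 3)) ∧
        h + R₀ ≤ p 2 ∧ p 2 ≤ h + 2 * R₀ ∧ p 0 ^ 2 + p 1 ^ 2 ≤ ρ ^ 2)) →
      (∀ p ∈ X, ∃ i j c k : ℤ, p = L ((i : ℝ) • triangularVec₁ (1 : ℝ) + (j : ℝ) • triangularVec₂ (1 : ℝ) +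
        (c : ℝ) • barlowOffset (1 : ℝ) + (k : ℝ) • layerNormal (Real.sqrt (2 / 3))) + s₁) →
      ((((P₁ ×ˢ (X \ P₁)).filter fun pq => dist pq.1 pq.2 = 1).card : ℕ) : ℝ) +
        ((((P₂ ×ˢ ((X \ P₁) \ P₂)).filter fun pq => dist pq.1 pq.2 = 1).card : ℕ) : ℝ) ≤
        contactDeficiency ((X \ P₁) \ P₂) +
          (Real.sqrt 2 / 4 * ∑ᶠ w ∈ {w ∈ fccStacking 1 (Real.sqrt (2 / 3)) | ‖w‖ = 1},
              |⟪w, A₁.symm (EuclideanSpace.single (2 : Fin 3) (1 : ℝ))⟫_ℝ| +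
            Real.sqrt 2 / 4 * ∑ᶠ w ∈ {w ∈ fccStacking 1 (Real.sqrt (2 / 3)) | ‖w‖ = 1},
              |⟪w, A₂.symm (EuclideanSpace.single (2 : Fin 3) (1 : ℝ))⟫_ℝ| -
            (2 * Real.sqrt 6 / 3 : ℝ) * Real.sqrt (1 - ⟪L (EuclideanSpace.single (2 : Fin 3) (1 : ℝ)),
              (EuclideanSpace.single (2 : Fin 3) (1 : ℝ))⟫_ℝ ^ 2)) * Real.pi * ρ ^ 2 +
          C * (1 + h) * ρ := by
  by_cases hcompat : ∃ i j c k : ℤ, s₂ = L ((i : ℝ) • triangularVec₁ (1 : ℝ) + (j : ℝ) • triangularVec₂ (1 : ℝ) +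
      (c : ℝ) • barlowOffset (1 : ℝ) + (k : ℝ) • layerNormal (Real.sqrt (2 / 3))) + s₁
  · -- compatible origins: the two-sided budget law with an empty budget
    obtain ⟨C, R₀, hR₀, hmain⟩ := coaxialTwoSlabAdhesion_offSite_twoSided A₁ t₁ A₂ t₂ L s₁ s₂ hσ hσ' hsub₁ hsub₂
      hne hcompat
    refine ⟨C, R₀, hR₀, ?_⟩
    intro h hh ρ hρ X P₁ P₂ hX hP₁X hP₂X hcell hP₁ hP₂ hlay
    have hfin := hmain h hh ρ hρ X P₁ P₂ hX hP₁X hP₂X hcell hP₁ hP₂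
    have hzero : ∀ z : EuclideanSpace ℝ (Fin 3), ((X.filter fun q => dist z q = 1 ∧ ¬ ∃ i j c k : ℤ,
        q = L ((i : ℝ) • triangularVec₁ (1 : ℝ) + (j : ℝ) • triangularVec₂ (1 : ℝ) + (c : ℝ) • barlowOffset (1 : ℝ) +
          (k : ℝ) • layerNormal (Real.sqrt (2 / 3))) + s₁).card : ℝ) = 0 := by
      intro z
      rw [Nat.cast_eq_zero, card_eq_zero, filter_eq_empty_iff]
      intro q hq hq'
      exact hq'.2 (hlay q hq)
    simp only [hzero, sum_const_zero, mul_zero, add_zero] at hfin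
    exact hfin
  · -- incompatible origins: no ball of `Λ₂` is a site, yet the top sample is not empty — vacuous
    refine ⟨0, 10, by norm_num, ?_⟩
    intro h hh ρ hρ X P₁ P₂ hX hP₁X hP₂X hcell hP₁ hP₂ hlay
    exfalso
    set e₃ : EuclideanSpace ℝ (Fin 3) := EuclideanSpace.single (2 : Fin 3) (1 : ℝ) with he₃
    obtain ⟨z, hzΛ, hzd⟩ := movedFcc_exists_dist_sq_le_half A₂ t₂ ((h + 15) • e₃)
    -- `z` lies in the top sample window
    have hsq := dist_sq_eq_three ((h + 15) • e₃) z
    have hc0 : ((h + 15) • e₃) 0 = 0 := by simp [he₃]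
    have hc1 : ((h + 15) • e₃) 1 = 0 := by simp [he₃]
    have hc2 : ((h + 15) • e₃) 2 = h + 15 := by simp [he₃]
    rw [hc0, hc1, hc2] at hsq
    have hρ10 : (10 : ℝ) ≤ ρ := hρ
    have hzP₂ : z ∈ P₂ := by
      rw [hP₂]
      refine ⟨hzΛ, ?_, ?_, ?_⟩
      · nlinarith [sq_nonneg (0 - z 0), sq_nonneg (0 - z 1), sq_nonneg (h + 15 - z 2 + 5)]
      · nlinarith [sq_nonneg (0 - z 0), sq_nonneg (0 - z 1), sq_nonneg (h + 15 - z 2 - 5)]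
      · nlinarith [sq_nonneg (h + 15 - z 2)]
    have hzX : z ∈ X := (hP₂X hzP₂) |> fun hz => (mem_sdiff.1 hz).1
    -- `z` is a site of `(L, s₁)` and a site of `(L, s₂)`: the origins are compatible
    obtain ⟨i, j, c, k, hz₁⟩ := hlay z hzX
    obtain ⟨i', j', c', k', hz₂⟩ := site_of_mem_coaxialGrain A₂ t₂ L s₂ hsub₂ z hzΛ
    apply hcompat
    refine ⟨i - i', j - j', c - c', k - k', ?_⟩
    have e : s₂ = z - L ((i' : ℝ) • triangularVec₁ (1 : ℝ) + (j' : ℝ) • triangularVec₂ (1 : ℝ) +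
        (c' : ℝ) • barlowOffset (1 : ℝ) + (k' : ℝ) • layerNormal (Real.sqrt (2 / 3))) := by
      rw [hz₂]; abel
    rw [e, hz₁]
    have : L ((((i - i' : ℤ)) : ℝ) • triangularVec₁ (1 : ℝ) + (((j - j' : ℤ)) : ℝ) • triangularVec₂ (1 : ℝ) +
        (((c - c' : ℤ)) : ℝ) • barlowOffset (1 : ℝ) + (((k - k' : ℤ)) : ℝ) • layerNormal (Real.sqrt (2 / 3))) =
        L ((i : ℝ) • triangularVec₁ (1 : ℝ) + (j : ℝ) • triangularVec₂ (1 : ℝ) + (c : ℝ) • barlowOffset (1 : ℝ) +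
          (k : ℝ) • layerNormal (Real.sqrt (2 / 3))) -
        L ((i' : ℝ) • triangularVec₁ (1 : ℝ) + (j' : ℝ) • triangularVec₂ (1 : ℝ) + (c' : ℝ) • barlowOffset (1 : ℝ) +
          (k' : ℝ) • layerNormal (Real.sqrt (2 / 3))) := by
      rw [← map_sub]; congr 1; push_cast; module
    rw [this]; abel

end Summit.Ventures.Crystal3D.Theorems

end
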